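import Mathlib

/-!
# Step dictionary for `NoPeriodicIsolatedAtom` / line `ridge_rank` — auxiliary file 1:
# coefficients of the homogeneous shear `X_j ↦ X_j + τ_j X_i` on monomials

Pure `MvPolynomial` bookkeeping used by the step dictionary `stub_stepDict` (crux
stmt-ResolutionOfSingularities-16344): for the `κ`-algebra map
`T : X_i ↦ X_i, X_j ↦ X_j + τ_j X_i (j ≠ i)` of `κ[X_1 … X_n]` we compute the coefficient of `X^B` in
`T (a X^m)` (`coeff_shear_monomial`, the homogeneous Taylor / binomial formula), and the companion
formulas for the substitution `X_i ↦ 0` (`aeval_kill_monomial`) and for evaluation of a monomial.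
Everything here is over an arbitrary field and independent of the blow-up calculus.
-/

noncomputable section

-- single-problem summit: the doubled namespace component is forced by the tree layout
set_option linter.dupNamespace false

namespace Summit.ResolutionOfSingularities.ResolutionOfSingularities.Theorems.NoPeriodicIsolatedAtom.RidgeRank.StepDict

open scoped BigOperators Classical
open MvPolynomial

variable {n : ℕ} {κ : Type} [Field κ]

/-- `∑_j (if j = i then 0 else f j) = ∑_{j ≠ i} f j`. [folklore] -/
theorem sum_ite_eq_sum_erase (i : Fin n) (f : Fin n → ℕ) :
    Finset.sum Finset.univ (fun j => if j = i then 0 else f j) = Finset.sum (Finset.univ.erase i) f := by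
  rw [← Finset.add_sum_erase _ _ (Finset.mem_univ i), if_pos rfl, zero_add]
  exact Finset.sum_congr rfl (fun j hj => if_neg (Finset.ne_of_mem_erase hj))

/-- The product `∏_j u_j ^ k_j` with `u_i = 0` and `u_j = X_j` otherwise vanishes unless `k_i = 0`,
in which case it is the monomial `X^k`. [folklore] -/
theorem prod_kill_pow (i : Fin n) (k : Fin n → ℕ) :
    Finset.prod Finset.univ (fun j => (if j = i then (0 : MvPolynomial (Fin n) κ) else X j) ^ (k j)) =
      if k i = 0 then monomial (Finsupp.equivFunOnFinite.symm k) 1 else 0 := by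
  by_cases hk : k i = 0
  · rw [if_pos hk, monomial_eq, C_1, one_mul, Finsupp.prod_fintype _ _ (fun _ => pow_zero _)]
    refine Finset.prod_congr rfl (fun j _ => ?_)
    rw [Finsupp.coe_equivFunOnFinite_symm]
    by_cases hj : j = i
    · subst hj; rw [if_pos rfl, hk, pow_zero, pow_zero]
    · rw [if_neg hj]
  · rw [if_neg hk]
    exact Finset.prod_eq_zero (Finset.mem_univ i) (by rw [if_pos rfl, zero_pow hk])

/-- One term of the expanded shear of a monomial: `∏_j u_j^{k_j} (τ'_j X_i)^{m_j - k_j} C(m_j, k_j)`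
is the monomial `X^{k + (∑_j (m_j - k_j)) e_i}` with coefficient `∏_j C(m_j,k_j) τ'_j^{m_j-k_j}`
(and `0` if `k_i ≠ 0`). [folklore] -/
theorem prod_shear_term (i : Fin n) (τ' : Fin n → κ) (m : Fin n →₀ ℕ) (k : Fin n → ℕ) :
    Finset.prod Finset.univ (fun j => (if j = i then (0 : MvPolynomial (Fin n) κ) else X j) ^ (k j) *
        (C (τ' j) * X i) ^ (m j - k j) * ((Nat.choose (m j) (k j) : ℕ) : MvPolynomial (Fin n) κ)) =
      if k i = 0 then
        monomial (Finsupp.equivFunOnFinite.symm k +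
            Finsupp.single i (Finset.sum Finset.univ (fun j => m j - k j)))
          (Finset.prod Finset.univ (fun j => ((Nat.choose (m j) (k j) : ℕ) : κ) * τ' j ^ (m j - k j)))
      else 0 := by
  rw [Finset.prod_mul_distrib, Finset.prod_mul_distrib, prod_kill_pow]
  by_cases hk : k i = 0
  · rw [if_pos hk, if_pos hk]
    have h1 : Finset.prod Finset.univ (fun j => (C (τ' j) * X i : MvPolynomial (Fin n) κ) ^ (m j - k j)) =
        C (Finset.prod Finset.univ (fun j => τ' j ^ (m j - k j))) *
          X i ^ (Finset.sum Finset.univ (fun j => m j - k j)) := by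
      rw [map_prod, ← Finset.prod_pow_eq_pow_sum, ← Finset.prod_mul_distrib]
      exact Finset.prod_congr rfl (fun j _ => by rw [mul_pow, map_pow])
    have h2 : Finset.prod Finset.univ (fun j => ((Nat.choose (m j) (k j) : ℕ) : MvPolynomial (Fin n) κ)) =
        C (Finset.prod Finset.univ (fun j => ((Nat.choose (m j) (k j) : ℕ) : κ))) := by
      rw [map_prod]
      exact Finset.prod_congr rfl (fun j _ => (map_natCast C _).symm)
    rw [h1, h2, X_pow_eq_monomial, C_mul_monomial, mul_one, monomial_mul, one_mul,
      mul_comm _ (C _), C_mul_monomial]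
    congr 1
    rw [← Finset.prod_mul_distrib]
  · rw [if_neg hk, if_neg hk, zero_mul, zero_mul]

/-- Coefficient form of `prod_shear_term`. [folklore] -/
theorem coeff_shear_term (i : Fin n) (τ' : Fin n → κ) (m : Fin n →₀ ℕ) (k : Fin n → ℕ)
    (B : Fin n →₀ ℕ) :
    coeff B (Finset.prod Finset.univ (fun j => (if j = i then (0 : MvPolynomial (Fin n) κ) else X j) ^ (k j) *
        (C (τ' j) * X i) ^ (m j - k j) * ((Nat.choose (m j) (k j) : ℕ) : MvPolynomial (Fin n) κ))) =
      if k i = 0 ∧ Finsupp.equivFunOnFinite.symm k +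
            Finsupp.single i (Finset.sum Finset.univ (fun j => m j - k j)) = B then
        Finset.prod Finset.univ (fun j => ((Nat.choose (m j) (k j) : ℕ) : κ) * τ' j ^ (m j - k j))
      else 0 := by
  rw [prod_shear_term]
  by_cases hk : k i = 0
  · simp only [hk, true_and, if_true, coeff_monomial]
  · simp only [hk, false_and, if_false, coeff_zero]

/-- **Homogeneous Taylor formula on a monomial.** The coefficient of `X^B` in
`T(a X^m)`, `T : X_i ↦ X_i, X_j ↦ X_j + τ_j X_i`, is `a ∏_{j ≠ i} C(m_j, B_j) τ_j^{m_j - B_j}` when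
`|m| = |B|` and `0` otherwise (the binomials vanish unless `B_j ≤ m_j` for `j ≠ i`). [folklore] -/
theorem coeff_shear_monomial (i : Fin n) (τ : Fin n → κ) (m B : Fin n →₀ ℕ) (a : κ) :
    coeff B (aeval (fun j : Fin n => if j = i then X i else X j + C (τ j) * X i) (monomial m a)) =
      if m.degree = B.degree then
        a * Finset.prod (Finset.univ.erase i)
          (fun j => ((Nat.choose (m j) (B j) : ℕ) : κ) * τ j ^ (m j - B j))
      else 0 := by
  -- uniformize the substitution: `t j = u j + C (τ' j) * X i` with `u i = 0`, `τ' i = 1`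
  have ht : (fun j : Fin n => if j = i then X i else X j + C (τ j) * X i) =
      fun j => (if j = i then (0 : MvPolynomial (Fin n) κ) else X j) +
        C (Function.update τ i 1 j) * X i := by
    funext j
    by_cases hj : j = i
    · subst hj; simp
    · simp [hj]
  rw [ht, aeval_monomial, algebraMap_eq, coeff_C_mul, Finsupp.prod_fintype _ _ (fun _ => pow_zero _)]
  simp_rw [add_pow, Finset.prod_univ_sum, coeff_sum, coeff_shear_term]
  -- the only candidate index
  set k₀ : Fin n → ℕ := fun j => if j = i then 0 else B j with hk₀
  have hcond : ∀ x : Fin n → ℕ, (x i = 0 ∧ Finsupp.equivFunOnFinite.symm x +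
      Finsupp.single i (Finset.sum Finset.univ (fun j => m j - x j)) = B) → x = k₀ := by
    rintro x ⟨hxi, hxB⟩
    funext j
    by_cases hj : j = i
    · subst hj; simp [k₀, hxi]
    · have h := DFunLike.congr_fun hxB j
      simp only [Finsupp.coe_add, Pi.add_apply, Finsupp.coe_equivFunOnFinite_symm,
        Finsupp.single_apply, if_neg (Ne.symm hj), add_zero] at h
      simp [k₀, hj, h]
  have hk₀i : k₀ i = 0 := by simp [k₀]
  have hdegB : B.degree = B i + Finset.sum (Finset.univ.erase i) (fun j => B j) := by
    rw [Finsupp.degree_eq_sum, ← Finset.add_sum_erase _ _ (Finset.mem_univ i)]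
  have hsumk₀ : Finset.sum Finset.univ k₀ = Finset.sum (Finset.univ.erase i) (fun j => B j) :=
    sum_ite_eq_sum_erase i (fun j => B j)
  by_cases H : ∀ j, j ≠ i → B j ≤ m j
  · -- every binomial may be nonzero; the sum is its `k₀` term
    have hle : ∀ j, k₀ j ≤ m j := by
      intro j
      by_cases hj : j = i
      · subst hj; simp [k₀]
      · simp only [k₀, if_neg hj]; exact H j hj
    have hmem : k₀ ∈ Fintype.piFinset (fun j => Finset.range (m j + 1)) := by
      rw [Fintype.mem_piFinset]
      intro j
      rw [Finset.mem_range]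
      exact Nat.lt_succ_of_le (hle j)
    rw [Finset.sum_eq_single_of_mem k₀ hmem (fun x _ hne => if_neg (fun h => hne (hcond x h)))]
    have he : Finset.sum Finset.univ (fun j => m j - k₀ j) =
        Finset.sum Finset.univ (fun j => m j) - Finset.sum (Finset.univ.erase i) (fun j => B j) := by
      rw [Finset.sum_tsub_distrib _ (fun j _ => hle j), hsumk₀]
    have hBle : Finset.sum (Finset.univ.erase i) (fun j => B j) ≤ Finset.sum Finset.univ (fun j => m j) := by
      rw [← hsumk₀]; exact Finset.sum_le_sum (fun j _ => hle j)
    have hdegm : m.degree = Finset.sum Finset.univ (fun j => m j) := Finsupp.degree_eq_sum m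
    by_cases hdeg : m.degree = B.degree
    · have hB : Finsupp.equivFunOnFinite.symm k₀ +
          Finsupp.single i (Finset.sum Finset.univ (fun j => m j - k₀ j)) = B := by
        ext j
        simp only [Finsupp.coe_add, Pi.add_apply, Finsupp.coe_equivFunOnFinite_symm,
          Finsupp.single_apply]
        by_cases hj : j = i
        · subst hj; rw [if_pos rfl, hk₀i, zero_add, he]; omega
        · rw [if_neg (Ne.symm hj), add_zero]; simp [k₀, hj]
      rw [if_pos hdeg, if_pos ⟨hk₀i, hB⟩, ← Finset.mul_prod_erase _ _ (Finset.mem_univ i)]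
      simp only [k₀, if_pos rfl, Nat.choose_zero_right, Nat.cast_one, Function.update_self, one_pow,
        one_mul]
      congr 1
      refine Finset.prod_congr rfl (fun j hj => ?_)
      rw [if_neg (Finset.ne_of_mem_erase hj), Function.update_of_ne (Finset.ne_of_mem_erase hj)]
    · rw [if_neg hdeg, if_neg, mul_zero]
      rintro ⟨_, h⟩
      apply hdeg
      have h' := DFunLike.congr_fun h i
      simp only [Finsupp.coe_add, Pi.add_apply, Finsupp.coe_equivFunOnFinite_symm,
        Finsupp.single_eq_same, hk₀i, zero_add, he] at h'
      omega
  · -- some binomial `C(m_j, B_j)` with `j ≠ i` vanishes: both sides are `0`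
    push Not at H
    obtain ⟨j, hji, hlt⟩ := H
    have hz : ((Nat.choose (m j) (B j) : ℕ) : κ) = 0 := by
      rw [Nat.choose_eq_zero_of_lt hlt, Nat.cast_zero]
    rw [Finset.sum_eq_zero, mul_zero]
    · split_ifs
      · rw [Finset.prod_eq_zero (Finset.mem_erase.mpr ⟨hji, Finset.mem_univ j⟩) (by rw [hz, zero_mul]),
          mul_zero]
      · rfl
    · intro x _
      split_ifs with hc
      · obtain rfl := hcond x hc
        exact Finset.prod_eq_zero (Finset.mem_univ j) (by simp only [k₀, if_neg hji]; rw [hz, zero_mul])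
      · rfl

/-- The substitution `X_i ↦ 0` kills the monomials containing `X_i` and fixes the others. [folklore] -/
theorem aeval_kill_monomial (i : Fin n) (m : Fin n →₀ ℕ) (a : κ) :
    aeval (fun j : Fin n => if j = i then (0 : MvPolynomial (Fin n) κ) else X j) (monomial m a) =
      if m i = 0 then monomial m a else 0 := by
  rw [aeval_monomial, algebraMap_eq, Finsupp.prod_fintype _ _ (fun _ => pow_zero _)]
  have h := prod_kill_pow (κ := κ) i ⇑m
  rw [Finsupp.equivFunOnFinite_symm_coe] at h
  rw [h]
  split_ifs
  · rw [C_mul_monomial, mul_one]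
  · rw [mul_zero]

/-- Coefficients after the substitution `X_i ↦ 0` on a monomial. [folklore] -/
theorem coeff_kill_monomial (i : Fin n) (m B : Fin n →₀ ℕ) (a : κ) :
    coeff B (aeval (fun j : Fin n => if j = i then (0 : MvPolynomial (Fin n) κ) else X j) (monomial m a)) =
      if m i = 0 ∧ m = B then a else 0 := by
  rw [aeval_kill_monomial]
  by_cases h : m i = 0
  · simp only [h, true_and, if_true, coeff_monomial]
  · simp only [h, false_and, if_false, coeff_zero]

/-- Evaluation of a monomial over `Fin n`: `a X^m ↦ a ∏_j σ_j^{m_j}`. [folklore] -/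
theorem eval_monomial_fintype (σ : Fin n → κ) (m : Fin n →₀ ℕ) (a : κ) :
    eval σ (monomial m a) = a * Finset.prod Finset.univ (fun j => σ j ^ (m j)) := by
  rw [eval_monomial, Finsupp.prod_fintype _ _ (fun _ => pow_zero _)]

/-- **Registered export** (stub `stepDict_coeff_shear_monomial` of crux stmt-ResolutionOfSingularities-16344):
the homogeneous Taylor formula on a monomial, closed form of `coeff_shear_monomial`. [folklore] -/
theorem stepDict_coeff_shear_monomial : ∀ {n : ℕ} {κ : Type} [Field κ] (i : Fin n) (τ : Fin n → κ) (m B : Fin n →₀ ℕ) (a : κ),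
    MvPolynomial.coeff B (MvPolynomial.aeval (fun j : Fin n => if j = i then MvPolynomial.X i else MvPolynomial.X j + MvPolynomial.C (τ j) * MvPolynomial.X i) (MvPolynomial.monomial m a)) =
      if m.degree = B.degree then a * Finset.prod (Finset.univ.erase i) (fun j => ((Nat.choose (m j) (B j) : ℕ) : κ) * τ j ^ (m j - B j)) else 0 :=
  fun i τ m B a => coeff_shear_monomial i τ m B a

end Summit.ResolutionOfSingularities.ResolutionOfSingularities.Theorems.NoPeriodicIsolatedAtom.RidgeRank.StepDict

end
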